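import Mathlib.Analysis.Fourier.LpSpace
import Mathlib.Analysis.Distribution.SchwartzSpace.Basic
import Mathlib.Analysis.CStarAlgebra.Matrix
import Mathlib.MeasureTheory.Function.Holder
import Mathlib.MeasureTheory.Measure.Lebesgue.EqHaar
import Mathlib.MeasureTheory.Integral.IntervalIntegral.Basic
import Literature.Analysis.FunctionSpaces.FourierSobolevNorm
import Literature.Analysis.FunctionSpaces.Complexify
import Literature.Analysis.FluidPDE.VectorCalculus
import HarnessLib

/-!
# Tao's blow-up theorem for an averaged Navier–Stokes equation, in its own `H¹⁰_df(ℝ³)` setting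

T. Tao, *Finite time blowup for an averaged three-dimensional Navier–Stokes equation*,
J. Amer. Math. Soc. **29** (2016), 601–674; arXiv:1402.0290v3 (the refereed version, held as
`paper:arxiv-1402.0290`; all theorem / equation numbers below are those of that text):
§1.1, pp. 3–7, equations (1.2)–(1.5), (1.9)–(1.16), Remark 1.4 and **Theorem 1.5**.

This file restates Theorem 1.5 (`averagedNS_blowup`) over the objects Tao actually uses —
the Hilbert space `L²(ℝ³)` with its Plancherel Fourier transform, the Sobolev class `H¹⁰_df(ℝ³)`,
bounded Fourier multipliers, and mild solutions valued in `H¹⁰_df` — because the tree's earlier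
rendering `Literature.Analysis.FluidPDE.tao_averaged_ns_blowup` (`Literature/Analysis/FluidPDE/TaoAveraged.lean`,
built on the function-level prelude `Literature/Analysis/FluidPDE/TaoAveragedEuler.lean`) is
**not the printed statement**:

1. *Symbol class.* Tao's real Fourier multipliers of order `0` (p. 6) have **complex** symbols
   `m : ℝ³ → ℂ`, smooth off the origin, with `sup_{ξ ≠ 0} |ξ|ᵏ |∇ᵏ m(ξ)| < ∞`, subject to the
   reality condition `m(-ξ) = \overline{m(ξ)}`; such a symbol has an even real part *and an odd
   imaginary part* (Riesz-transform-like multipliers), and the proof of his Theorem 3.2 (p. 15,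
   "taking real parts" of complex averages) uses the odd ones. The prelude's
   `Fluid.TaoAverageData` only carries real-valued symbols `ℝ³ → ℝ` and `Fluid.multiplierApply`
   discards everything but their even part, so `Fluid.IsAveragedEulerBilinear` is a strictly
   smaller class and the tree's `∃ B, IsAveragedEulerBilinear B ∧ …` is not implied by the source.
2. *Solution concept.* Tao's `B̃` is a bounded bilinear map
   `H¹⁰_df × H¹⁰_df → (H¹⁰_df)*` **defined by duality** ((1.12)–(1.13)), and a mild solution is a
   *continuous map `u : I → H¹⁰_df(ℝ³)`* obeying the Duhamel identity (1.15) in that space. The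
   prelude instead evaluates pointwise Bochner/Fourier integrals of everywhere-defined fields
   (documented there as "junk `0`" off `L¹`), and the tree's statement denies the existence of
   *any* `u : ℝ → ℝ³ → ℝ³` with `u t ∈ C¹⁰ ∩ H¹⁰` satisfying a pointwise identity built from
   those surrogates — a different assertion, whose truth the paper does not address.
3. *Locators.* The main theorem is Theorem **1.5** (the tree says "1.4"); the dilation is
   (1.11) with exponent `3/2` (resolving the prelude's "`σ` unverified" flag), the averaged
   operator is (1.12)/(1.13), mild solutions are (1.15) and the cancellation property is (1.16).
   (Tao's `σ = 3/2`, `SO(3)`-valued rotations, `λ ∈ [C⁻¹, C]` and the moment bounds are all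
   encoded below; the prelude leaves them free, which only widens the class.)

Nothing in the two older files is edited; this file is self-contained on top of the accepted
`Literature.Analysis.FunctionSpaces.eFourierSobolevNorm` (`Literature/Analysis/FunctionSpaces/FourierSobolevNorm.lean`),
`Literature.Analysis.FunctionSpaces.EuclideanSpace.complexify` and `Literature.Analysis.FluidPDE.VectorCalculus.IsDivFree`.

## The setting (Tao 2016, §1.1), and how it is encoded

* Real vector fields are handled inside the complex Hilbert space
  `L2C = L²(ℝ³; ℂ³) = Lp (EuclideanSpace ℂ (Fin 3)) 2 volume` (Mathlib's `L²` Fourier transform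
  `𝓕 : L2C ≃ₗᵢ[ℂ] L2C`, `MeasureTheory.Lp.fourierTransformₗᵢ`, needs complex scalars), cut out
  by the predicate `IsReal` (all components a.e. real). Real Schwartz data `u₀ : 𝓢(ℝ³, ℝ³)` enter
  through `schwartzL2 u₀` (the class of `complexify ∘ u₀`).
* `H¹⁰_df(ℝ³)` (p. 3: `H¹⁰` Sobolev fields, divergence free in the distributional sense) is the
  predicate `MemH10df u`: `‖u‖_{H¹⁰} = eFourierSobolevNorm 10 u < ∞`, `IsReal u`, and
  `ξ · û(ξ) = 0` for a.e. `ξ` (`IsFourierDivFree`; this is the Fourier transcription of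
  `∇ · u = 0`, used by Tao himself on p. 3: "the divergence-free condition ensures that
  `û(ξ₁) ∈ ξ₁^⊥` for (almost) all `ξ₁`"). Continuity of `u : I → H¹⁰_df` is `ContinuousInH10On`
  (`‖u t − u t₀‖_{H¹⁰} → 0` within `I`).
* The `L²` pairing `⟨u, v⟩ = ∫ u · v dx` (p. 3) is `pairing` (complex *bilinear*; on real fields
  it is the real pairing), and the Euler trilinear form `⟨B(u,v), w⟩` is `eulerForm`, written in
  Fourier variables exactly as Tao's (1.3)–(1.4):
  `⟨B(u,v), w⟩ = -πi ∫∫ Λ_{ξ₁,ξ₂,ξ₃}(û(ξ₁), v̂(ξ₂), ŵ(ξ₃)) dξ₁ dξ₂`, `ξ₃ = -ξ₁-ξ₂`,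
  `Λ(X₁,X₂,X₃) = (X₁·ξ₂)(X₂·X₃) + (X₂·ξ₁)(X₁·X₃)`. (Tao *defines* `B` by the `x`-space duality
  formula `-½ ∫ ((u·∇)v)·w + ((v·∇)u)·w` and records (1.3) as the equivalent Fourier expression
  on `H¹⁰_df`; the Fourier form is used here because it needs no pointwise derivatives of `L²`
  classes. For `u, v, w ∈ H¹⁰` the double integral converges absolutely.)
* Fourier multipliers with essentially bounded symbol act on `L2C` by
  `fourierMultiplier m u = 𝓕⁻¹(m • 𝓕u)` (Mathlib's `L^∞ • L²` product); real order-`0` symbols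
  (`IsRealSymbol`: smooth off `0`, all seminorms `symbolSeminorm k` (1.10) finite, reality
  condition) are essentially bounded (`IsRealSymbol.memLp_top`, proved). Rotations
  `Rot_R u (x) = R u(R⁻¹x)` (`rot`, `R` a linear isometry with `det R = 1`, i.e. `R ∈ SO(3)`),
  dilations `Dil_λ u (x) = λ^{3/2} u(λx)` ((1.11), `dil`) and the heat semigroup
  `e^{τΔ} = 𝓕⁻¹ e^{-4π²τ|ξ|²} 𝓕` (`heat`) are honest operators on `L2C`.
* `AveragingDatum` is exactly the data of (1.13): a probability space, three random real
  order-`0` symbols, three random rotations in `SO(3)`, three random dilation factors in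
  `[C⁻¹, C]`, with Tao's moment bounds `𝔼 ‖m₁‖_{k₁} ‖m₂‖_{k₂} ‖m₃‖_{k₃} < ∞` for all `kᵢ`.
  Tao asks `ω ↦ m_{i,ω}` to be Borel measurable into the Fréchet space `𝓜₀`; we record the
  (implied, weaker) measurability of `ω ↦ m_{i,ω}(ξ)` for `ξ ≠ 0` (evaluation at `ξ ≠ 0` is
  continuous on `𝓜₀`, `|m(ξ)| ≤ ‖m‖₀`), of `ω ↦ R_{i,ω} x` and of `ω ↦ λ_{i,ω}`, which only
  widens the class (harmless for an existence statement). `𝒜.form u v w = ⟨B̃(u,v), w⟩` is (1.13).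
* **Mild solutions, (1.15).** `B̃(u,v)` is an element of `(H¹⁰_df)*`, `e^{τΔ}` acts on that dual
  by transposition (its symbol is real and even, so `⟨e^{τΔ}f, w⟩ = ⟨f, e^{τΔ}w⟩`), and an
  identity in `(H¹⁰_df)*` is an identity of pairings against every `w ∈ H¹⁰_df`. Hence (1.15),
  `u(t) = e^{tΔ}u₀ + ∫₀ᵗ e^{(t-t')Δ} B̃(u(t'),u(t')) dt'`, is recorded as
  `⟨u(t), w⟩ = ⟨e^{tΔ}u₀, w⟩ + ∫₀ᵗ ⟨B̃(u(t'),u(t')), e^{(t-t')Δ} w⟩ dt'` for all `w ∈ H¹⁰_df`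
  (`AveragingDatum.IsMildSolution`), together with `u t ∈ H¹⁰_df` and continuity in `H¹⁰`.
  For Tao's operators `B̃(u,v) ∈ L²` ((1.14)), and then this is also (1.15) read in `L²`.
* **Representatives.** `fourierFn u` and the coercions `(u : ℝ³ → ℂ³)` are a.e.-defined
  representatives; every definition below uses them only under `∀ᵐ`, inside integrals, or
  composed with the submersions `(ξ₁, ξ₂) ↦ ξᵢ`, `(ξ₁, ξ₂) ↦ -ξ₁-ξ₂` (quasi-measure-preserving),
  so nothing depends on the choice of representative.
* **Junk values.** `pairing` is junk-free on `L²` (Cauchy–Schwarz). `eulerForm`, `form` and the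
  time integral are Bochner integrals, hence `0` where not integrable; under the hypotheses in
  which they are used below (arguments in `H¹⁰_df`, data obeying the moment bounds, `u`
  continuous in `H¹⁰`) they converge (Tao, p. 7: "the expectation in (1.12) is absolutely
  convergent for any `u, v, w ∈ H¹⁰_df`"). `dil 0` is the identity and `heat τ = heat 0 = id`
  for `τ < 0` (never used: `λ > 0`, `0 ≤ t' ≤ t`).

## Mathlib / tree search

Used from Mathlib (this pin): `MeasureTheory.Lp.fourierTransformₗᵢ` and the `𝓕`/`𝓕⁻` notation
instances on `Lp F 2` (`Mathlib/Analysis/Fourier/LpSpace.lean`), the `L^∞ • L²` product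
(`Mathlib/MeasureTheory/Function/Holder.lean`), `Lp.compMeasurePreserving`,
`LinearIsometryEquiv.measurePreserving`, `ContinuousLinearMap.compLp`, `Measure.map_addHaar_smul`
(dilations), `Matrix.toEuclideanCLM` (complexified rotation matrices), `SchwartzMap.memLp`,
`intervalIntegral`. Mathlib has the predicate `TemperedDistribution.MemSobolev`
(`Mathlib/Analysis/Distribution/Sobolev.lean`) but no bundled Sobolev space of vector fields,
no order-`0` (Hörmander–Mikhlin) symbol class and nothing on Navier–Stokes (grep `Mikhlin`,
`Hormander`, `NavierStokes`, `solenoidal`: no Mathlib file): the `H¹⁰` norm is the accepted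
`Literature.Analysis.FunctionSpaces.eFourierSobolevNorm` (equal to Mathlib's Bessel-potential norm for `p = 2`);
`Literature.Analysis.FunctionSpaces.BesselSobolev` (bundled `H^{s,p}` inside `𝓢'`) is not used because order-`0` multipliers,
being non-smooth at `ξ = 0`, do not act on `𝓢'`, whereas they act boundedly on `L²`.

## References

* T. Tao, *Finite time blowup for an averaged three-dimensional Navier–Stokes equation*,
  J. Amer. Math. Soc. 29 (2016), 601–674, arXiv:1402.0290v3: §1.1, (1.2)–(1.5), (1.9)–(1.16),
  Remark 1.4, Theorem 1.5; §3, Theorems 3.2–3.3 (structure of the proof). Keys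
  `Tao2016AveragedNS` (= interim key `arXiv14020290` of the older files).
-/

noncomputable section

open MeasureTheory Set Filter Topology FourierTransform Complex
open scoped ENNReal NNReal SchwartzMap ComplexConjugate

namespace Literature.Analysis.FluidPDE.Tao2016

/-- Local notation for physical / frequency space `ℝ³`. -/
local notation "ℝ³" => EuclideanSpace ℝ (Fin 3)
/-- Local notation for the complexified range `ℂ³`. -/
local notation "ℂ³" => EuclideanSpace ℂ (Fin 3)

/-! ### The ambient Hilbert space and `H¹⁰_df(ℝ³)` -/

/-- The ambient complex Hilbert space `L²(ℝ³; ℂ³)` in which Tao's real vector fields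
`u ∈ L²(ℝ³; ℝ³)` are embedded componentwise (Tao 2016, §1.1; complex scalars are forced by
Mathlib's `L²` Fourier transform). [cite: Tao2016AveragedNS, §1.1] -/
abbrev L2C : Type :=
  Lp (EuclideanSpace ℂ (Fin 3)) 2 (volume : Measure (EuclideanSpace ℝ (Fin 3)))

/-- The complex **bilinear** dot product `a · b = ∑ᵢ aᵢ bᵢ` on `ℂ³` (no complex conjugate;
Tao 2016, p. 15: "the inner product is complex bilinear rather than sesquilinear"). [cite: Tao2016AveragedNS, §3.1] -/
def cdot (a b : ℂ³) : ℂ := ∑ i, a i * b i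

/-- The `L²` pairing `⟨u, w⟩ = ∫_{ℝ³} u · w dx` (Tao 2016, §1.1, p. 3), extended bilinearly to
complexified fields; for real fields it is the real `L²` inner product. Junk-free on `L²`
(the integrand is integrable by Cauchy–Schwarz). [cite: Tao2016AveragedNS, §1.1] -/
def pairing (u w : L2C) : ℂ := ∫ x, cdot ((u : ℝ³ → ℂ³) x) ((w : ℝ³ → ℂ³) x)

/-- A complexified field is **real**: all its components are a.e. real (Tao's fields are
`u : ℝ³ → ℝ³`). [cite: Tao2016AveragedNS, §1.1] -/
def IsReal (u : L2C) : Prop :=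
  ∀ᵐ x ∂(volume : Measure ℝ³), ∀ i, ((u : ℝ³ → ℂ³) x i).im = 0

/-- A representative `û : ℝ³ → ℂ³` of the Plancherel Fourier transform of `u ∈ L²(ℝ³; ℂ³)`
(Tao's normalisation `û(ξ) = ∫ u(x) e^{-2πi x·ξ} dx`, p. 3, is Mathlib's). [cite: Tao2016AveragedNS, §1.1] -/
def fourierFn (u : L2C) : ℝ³ → ℂ³ := ((𝓕 u : L2C) : ℝ³ → ℂ³)

/-- **Divergence free** in the distributional sense, transcribed on the Fourier side:
`ξ · û(ξ) = 0` for a.e. `ξ` (Tao 2016, p. 3: "the divergence-free condition ensures that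
`û(ξ₁) ∈ ξ₁^⊥` for (almost) all `ξ₁`"; for `u ∈ L²`, `∇·u = 0` in `𝓢'` iff `2πi ξ·û = 0` a.e.). [cite: Tao2016AveragedNS, §1.1] -/
def IsFourierDivFree (u : L2C) : Prop :=
  ∀ᵐ ξ ∂(volume : Measure ℝ³), cdot (FunctionSpaces.EuclideanSpace.complexify ξ) (fourierFn u ξ) = 0

/-- Membership in **`H¹⁰_df(ℝ³)`** (Tao 2016, §1.1, p. 3): the real vector fields with `H¹⁰`
regularity, `‖u‖²_{H¹⁰} = ∫ (1+|ξ|²)^{10} |û(ξ)|² dξ < ∞` (the accepted `eFourierSobolevNorm 10`,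
equal to Mathlib's Bessel-potential norm), that are divergence free in the distributional
sense. [cite: Tao2016AveragedNS, §1.1] -/
def MemH10df (u : L2C) : Prop :=
  FunctionSpaces.eFourierSobolevNorm 10 u < ∞ ∧ IsReal u ∧ IsFourierDivFree u

/-- **Continuity of `u : I → H¹⁰(ℝ³)`** on a time set `I` (Tao 2016, p. 4 and (1.15): "a
continuous map `u : I → H¹⁰_df(ℝ³)`"): `‖u t − u t₀‖_{H¹⁰} → 0` as `t → t₀` within `I`. [cite: Tao2016AveragedNS, §1.1 (1.15)] -/
def ContinuousInH10On (I : Set ℝ) (u : ℝ → L2C) : Prop :=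
  ∀ t₀ ∈ I, Tendsto (fun t => FunctionSpaces.eFourierSobolevNorm 10 (u t - u t₀)) (𝓝[I] t₀) (𝓝 0)

/-- `ContinuousInH10On` is monotone in the time set. [folklore] -/
theorem ContinuousInH10On.mono {I J : Set ℝ} {u : ℝ → L2C} (hu : ContinuousInH10On I u)
    (h : J ⊆ I) : ContinuousInH10On J u :=
  fun t₀ ht₀ => (hu t₀ (h ht₀)).mono_left (nhdsWithin_mono _ h)

/-! ### The Euler trilinear form (Tao (1.3)–(1.4)) -/

/-- Tao's trilinear symbol (1.4):
`Λ_{ξ₁,ξ₂,ξ₃}(X₁, X₂, X₃) = (X₁ · ξ₂)(X₂ · X₃) + (X₂ · ξ₁)(X₁ · X₃)` (it depends on `ξ₁, ξ₂`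
only; products are complex bilinear). [cite: Tao2016AveragedNS, (1.4)] -/
def Λ (ξ₁ ξ₂ : ℝ³) (X₁ X₂ X₃ : ℂ³) : ℂ :=
  cdot X₁ (FunctionSpaces.EuclideanSpace.complexify ξ₂) * cdot X₂ X₃ +
    cdot X₂ (FunctionSpaces.EuclideanSpace.complexify ξ₁) * cdot X₁ X₃

/-- `Λ` is symmetric under exchanging the first two slots together with their frequencies. [cite: Tao2016AveragedNS, (1.4)] -/
theorem Λ_swap (ξ₁ ξ₂ : ℝ³) (X₁ X₂ X₃ : ℂ³) : Λ ξ₂ ξ₁ X₂ X₁ X₃ = Λ ξ₁ ξ₂ X₁ X₂ X₃ := by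
  unfold Λ
  ring

/-- The **Euler trilinear form** `⟨B(u,v), w⟩`, `B(u,v) = -½ P[(u·∇)v + (v·∇)u]`, in Fourier
variables (Tao 2016, (1.3)):
`⟨B(u,v), w⟩ = -πi ∫_{ξ₁+ξ₂+ξ₃=0} Λ_{ξ₁,ξ₂,ξ₃}(û(ξ₁), v̂(ξ₂), ŵ(ξ₃))`, where
`∫_{ξ₁+ξ₂+ξ₃=0} F := ∫∫ F(ξ₁, ξ₂, -ξ₁-ξ₂) dξ₁ dξ₂`. Tao defines `B` on `H¹⁰_df` by the `x`-space
duality formula `-½ ∫ ((u·∇)v)·w + ((v·∇)u)·w` (p. 3) and records (1.3) as its Fourier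
expression; for `u, v, w ∈ H¹⁰(ℝ³)` the double integral converges absolutely (`û ∈ L¹`,
`|ξ| v̂ ∈ L²`). Bochner junk `0` where not integrable. [cite: Tao2016AveragedNS, (1.3)] -/
def eulerForm (u v w : L2C) : ℂ :=
  -(Real.pi * I) *
    ∫ p : ℝ³ × ℝ³, Λ p.1 p.2 (fourierFn u p.1) (fourierFn v p.2) (fourierFn w (-p.1 - p.2))

/-- **Symmetry of the Euler bilinear operator**, `⟨B(u,v), w⟩ = ⟨B(v,u), w⟩` (Tao 2016, p. 3:
`B(u,v) = -½P[(u·∇)v + (v·∇)u]` is symmetric by construction); here from the symmetry of `Λ`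
and the measure-preserving swap `(ξ₁, ξ₂) ↦ (ξ₂, ξ₁)`. [cite: Tao2016AveragedNS, §1.1] -/
theorem eulerForm_symm (u v w : L2C) : eulerForm u v w = eulerForm v u w := by
  unfold eulerForm
  congr 1
  have h := integral_prod_swap (μ := (volume : Measure ℝ³)) (ν := (volume : Measure ℝ³))
    (fun p : ℝ³ × ℝ³ =>
      Λ p.1 p.2 (fourierFn v p.1) (fourierFn u p.2) (fourierFn w (-p.1 - p.2)))
  rw [Measure.volume_eq_prod, ← h]
  refine integral_congr_ae (Eventually.of_forall fun p => ?_)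
  simp only [Prod.fst_swap, Prod.snd_swap]
  rw [Λ_swap]
  congr 2
  abel

/-! ### Real Fourier multipliers of order `0`, rotations, dilations, heat flow on `L²` -/

/-- The **symbol seminorms** `‖m‖_k = sup_{ξ ≠ 0} |ξ|ᵏ ‖∇ᵏ m(ξ)‖` of Tao 2016, (1.10)
(`ℝ≥0∞`-valued; `∇ᵏ m` is `iteratedFDeriv ℝ k m`, whose operator norm is equivalent, with
constants depending only on `k`, to any tensor norm of `∇ᵏm`, so finiteness and the moment
conditions below are unaffected). [cite: Tao2016AveragedNS, (1.10)] -/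
def symbolSeminorm (k : ℕ) (m : ℝ³ → ℂ) : ℝ≥0∞ :=
  ⨆ ξ ∈ ({0}ᶜ : Set ℝ³), (‖ξ‖₊ : ℝ≥0∞) ^ k * ‖iteratedFDeriv ℝ k m ξ‖₊

/-- The symbols of **real Fourier multipliers of order `0`**, Tao's class `𝓜₀` (2016, p. 6):
`m : ℝ³ → ℂ` smooth away from the origin, all seminorms `‖m‖_k` (1.10) finite, and the reality
condition `m(-ξ) = \overline{m(ξ)}` for `ξ ≠ 0` (so that `m(D)` maps real fields to real
fields; e.g. even real symbols and odd purely imaginary ones such as the Riesz transforms).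
The value `m 0` is irrelevant (a null set). [cite: Tao2016AveragedNS, §1.1 p. 6] -/
def IsRealSymbol (m : ℝ³ → ℂ) : Prop :=
  ContDiffOn ℝ ((⊤ : ℕ∞) : WithTop ℕ∞) m {0}ᶜ ∧ (∀ k, symbolSeminorm k m < ∞) ∧
    ∀ ξ, ξ ≠ 0 → m (-ξ) = conj (m ξ)

/-- An order-`0` symbol is measurable and essentially bounded (by `‖m‖₀`), hence defines an
`L^∞` class; this is what makes `m(D)` a bounded operator on `L²`-Sobolev spaces (Plancherel;
no Hörmander–Mikhlin theory is needed on `L²`). [cite: Tao2016AveragedNS, §1.1 p. 6] -/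
theorem IsRealSymbol.memLp_top {m : ℝ³ → ℂ} (hm : IsRealSymbol m) :
    MemLp m ∞ (volume : Measure ℝ³) := by
  obtain ⟨hsmooth, hsemi, -⟩ := hm
  have hmeas : Measurable m :=
    measurable_of_continuousOn_compl_singleton 0 hsmooth.continuousOn
  refine memLp_top_of_bound hmeas.aestronglyMeasurable (symbolSeminorm 0 m).toReal ?_
  have h0 : ({0}ᶜ : Set ℝ³) ∈ ae (volume : Measure ℝ³) :=
    compl_mem_ae_iff.mpr (measure_singleton _)
  filter_upwards [h0] with ξ hξ
  have hle : (‖m ξ‖₊ : ℝ≥0∞) ≤ symbolSeminorm 0 m := by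
    have : (‖m ξ‖₊ : ℝ≥0∞) = (‖ξ‖₊ : ℝ≥0∞) ^ 0 * ‖iteratedFDeriv ℝ 0 m ξ‖₊ := by
      rw [pow_zero, one_mul, ENNReal.coe_inj, ← NNReal.coe_inj, coe_nnnorm, coe_nnnorm,
        norm_iteratedFDeriv_zero]
    rw [this]
    exact le_iSup₂ (f := fun (ξ : ℝ³) (_ : ξ ∈ ({0}ᶜ : Set ℝ³)) =>
      (‖ξ‖₊ : ℝ≥0∞) ^ 0 * (‖iteratedFDeriv ℝ 0 m ξ‖₊ : ℝ≥0∞)) ξ hξ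
  calc ‖m ξ‖ = ((‖m ξ‖₊ : ℝ≥0∞)).toReal := by simp
    _ ≤ (symbolSeminorm 0 m).toReal := ENNReal.toReal_mono (hsemi 0).ne hle

/-- Constant real symbols are real order-`0` symbols (all seminorms with `k ≥ 1` vanish). In
particular `m ≡ 1`, for which `m(D) = id` and `B` itself is an averaged Euler operator. [folklore] -/
theorem isRealSymbol_const (c : ℝ) : IsRealSymbol (fun _ : ℝ³ => (c : ℂ)) := by
  refine ⟨contDiffOn_const, fun k => ?_, fun ξ _ => (Complex.conj_ofReal c).symm ▸ rfl⟩
  rcases Nat.eq_zero_or_pos k with rfl | hk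
  · refine lt_of_le_of_lt (iSup₂_le fun ξ _ => ?_) (ENNReal.coe_lt_top (r := ‖(c : ℂ)‖₊))
    rw [pow_zero, one_mul, ENNReal.coe_le_coe, ← NNReal.coe_le_coe, coe_nnnorm, coe_nnnorm,
      norm_iteratedFDeriv_zero]
  · have h0 : ∀ ξ : ℝ³, iteratedFDeriv ℝ k (fun _ : ℝ³ => (c : ℂ)) ξ = 0 := fun ξ => by
      rw [iteratedFDeriv_const_of_ne hk.ne']
      rfl
    simp [symbolSeminorm, h0]

/-- The **Fourier multiplier** with essentially bounded symbol `m` acting on `L²(ℝ³; ℂ³)`,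
`m(D) u = 𝓕⁻¹(m · 𝓕u)` (Tao 2016, p. 6: `\widehat{m(D)u}(ξ) = m(ξ) û(ξ)`), through Mathlib's
Plancherel isometry and the `L^∞ • L²` product; a bounded operator, no junk. [cite: Tao2016AveragedNS, §1.1 p. 6] -/
def fourierMultiplier (m : Lp ℂ ∞ (volume : Measure ℝ³)) (u : L2C) : L2C :=
  (𝓕⁻ ((m • (𝓕 u : L2C) : L2C)) : L2C)

/-- The trivial multiplier `m ≡ 1` is the identity of `L²` (Plancherel inversion). [folklore] -/
theorem fourierMultiplier_one (u : L2C) :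
    fourierMultiplier ((memLp_top_const (μ := (volume : Measure ℝ³)) (1 : ℂ)).toLp _) u = u := by
  unfold fourierMultiplier
  have h : ((memLp_top_const (μ := (volume : Measure ℝ³)) (1 : ℂ)).toLp _ • (𝓕 u : L2C) : L2C) =
      𝓕 u := by
    apply Lp.ext
    filter_upwards [Lp.coeFn_lpSMul (r := 2)
        ((memLp_top_const (μ := (volume : Measure ℝ³)) (1 : ℂ)).toLp _) (𝓕 u : L2C),
      MemLp.coeFn_toLp (memLp_top_const (μ := (volume : Measure ℝ³)) (1 : ℂ))] with x hx h1
    rw [hx, Pi.smul_apply', h1, one_smul]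
  rw [h]
  exact fourierInv_fourier_eq u

/-- The heat symbol `e^{-4π²τ|ξ|²}` of `e^{τΔ}` in Tao's Fourier normalisation, for `τ ≥ 0`
(frozen at its `τ = 0` value `1` for `τ < 0`, a documented junk extension). [cite: Tao2016AveragedNS, (1.5)] -/
def heatSymbol (τ : ℝ) (ξ : ℝ³) : ℂ :=
  ((Real.exp (-(4 * Real.pi ^ 2 * max τ 0 * ‖ξ‖ ^ 2)) : ℝ) : ℂ)

/-- The heat symbol is continuous. [folklore] -/
theorem continuous_heatSymbol (τ : ℝ) : Continuous (heatSymbol τ) := by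
  unfold heatSymbol
  fun_prop

/-- The heat symbol is bounded by `1`. [folklore] -/
theorem norm_heatSymbol_le (τ : ℝ) (ξ : ℝ³) : ‖heatSymbol τ ξ‖ ≤ 1 := by
  unfold heatSymbol
  rw [Complex.norm_real, Real.norm_eq_abs, abs_of_pos (Real.exp_pos _), Real.exp_le_one_iff,
    neg_nonpos]
  positivity

/-- The heat symbol is an `L^∞` symbol. [folklore] -/
theorem memLp_top_heatSymbol (τ : ℝ) : MemLp (heatSymbol τ) ∞ (volume : Measure ℝ³) :=
  memLp_top_of_bound (continuous_heatSymbol τ).aestronglyMeasurable 1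
    (Eventually.of_forall (norm_heatSymbol_le τ))

/-- The **heat propagator** `e^{τΔ}` on `L²(ℝ³; ℂ³)`, `τ ≥ 0` (Tao 2016, (1.5)/(1.15): "the usual
heat propagators (defined on `L²(ℝ³)`, for instance)"), as the Fourier multiplier
`e^{-4π²τ|ξ|²}`; it maps `H¹⁰_df` to itself (`H^s`-contraction and divergence part proved
below, `eFourierSobolevNorm_heat_le`, `IsFourierDivFree.heat`; realness of `e^{τΔ}u` for real
`u` is true but not proved here). For `τ < 0` it is the identity (junk). [cite: Tao2016AveragedNS, (1.15)] -/
def heat (τ : ℝ) (u : L2C) : L2C :=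
  fourierMultiplier ((memLp_top_heatSymbol τ).toLp _) u

/-- `e^{0Δ} = id`. [folklore] -/
theorem heat_zero (u : L2C) : heat 0 u = u := by
  have h : (memLp_top_heatSymbol 0).toLp (heatSymbol 0) =
      (memLp_top_const (μ := (volume : Measure ℝ³)) (1 : ℂ)).toLp (fun _ : ℝ³ => (1 : ℂ)) := by
    refine MemLp.toLp_congr _ _ (Eventually.of_forall fun ξ => ?_)
    simp [heatSymbol]
  rw [heat, h, fourierMultiplier_one]

/-- The Fourier transform of `m(D) u` is `m û` (a.e.): `\widehat{m(D)u} = m û` (Tao 2016, p. 6). [cite: Tao2016AveragedNS, §1.1 p. 6] -/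
theorem fourierFn_fourierMultiplier (m : Lp ℂ ∞ (volume : Measure ℝ³)) (u : L2C) :
    fourierFn (fourierMultiplier m u) =ᵐ[volume] fun ξ => (m : ℝ³ → ℂ) ξ • fourierFn u ξ := by
  unfold fourierFn fourierMultiplier
  rw [fourier_fourierInv_eq]
  exact Lp.coeFn_lpSMul (r := 2) m (𝓕 u : L2C)

/-- The Fourier transform of `e^{τΔ}u` is `e^{-4π²τ|ξ|²} û` (a.e.). [folklore] -/
theorem fourierFn_heat (τ : ℝ) (u : L2C) :
    fourierFn (heat τ u) =ᵐ[volume] fun ξ => heatSymbol τ ξ • fourierFn u ξ := by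
  unfold heat
  filter_upwards [fourierFn_fourierMultiplier ((memLp_top_heatSymbol τ).toLp _) u,
    MemLp.coeFn_toLp (memLp_top_heatSymbol τ)] with ξ h1 h2
  rw [h1, h2]

/-- The heat symbol is bounded by `1` (`ℝ≥0∞` form). [folklore] -/
theorem enorm_heatSymbol_le (τ : ℝ) (ξ : ℝ³) : ‖heatSymbol τ ξ‖ₑ ≤ 1 := by
  rw [← ofReal_norm, ← ENNReal.ofReal_one]
  exact ENNReal.ofReal_le_ofReal (norm_heatSymbol_le τ ξ)

/-- **`e^{τΔ}` is a contraction for every Sobolev norm `H^s`** (in particular it maps `H¹⁰`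
to itself). [folklore] -/
theorem eFourierSobolevNorm_heat_le (s τ : ℝ) (u : L2C) :
    FunctionSpaces.eFourierSobolevNorm s (heat τ u) ≤ FunctionSpaces.eFourierSobolevNorm s u := by
  unfold FunctionSpaces.eFourierSobolevNorm
  refine ENNReal.rpow_le_rpow ?_ (by norm_num)
  refine lintegral_mono_ae ?_
  filter_upwards [fourierFn_heat τ u] with ξ hξ
  change _ * ‖fourierFn (heat τ u) ξ‖ₑ ^ 2 ≤ _ * ‖fourierFn u ξ‖ₑ ^ 2
  rw [hξ, enorm_smul]
  gcongr
  exact mul_le_of_le_one_left zero_le (enorm_heatSymbol_le τ ξ)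

/-- `cdot` is linear in its second argument. [folklore] -/
theorem cdot_smul_right (a : ℂ³) (c : ℂ) (b : ℂ³) : cdot a (c • b) = c * cdot a b := by
  simp [cdot, Finset.mul_sum, mul_left_comm]

/-- **`e^{τΔ}` preserves divergence-freeness** (a scalar Fourier multiplier commutes with
`ξ ·`). Together with `eFourierSobolevNorm_heat_le` this gives `e^{τΔ} H¹⁰_df ⊆ H¹⁰_df` up to
the (true, here unproved) preservation of realness. [folklore] -/
theorem IsFourierDivFree.heat {u : L2C} (hu : IsFourierDivFree u) (τ : ℝ) :
    IsFourierDivFree (heat τ u) := by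
  unfold IsFourierDivFree at *
  filter_upwards [hu, fourierFn_heat τ u] with ξ h1 h2
  rw [h2, cdot_smul_right, h1, mul_zero]

/-- The complexification `T ⊗ 1 : ℂ³ →L[ℂ] ℂ³` of a real linear map `T` of `ℝ³` (the real
matrix of `T` in the standard basis, acting on `ℂ³`); used to let a rotation act on the values
of a complexified field. [folklore] -/
def complexifyCLM (T : ℝ³ →L[ℝ] ℝ³) : ℂ³ →L[ℂ] ℂ³ :=
  Matrix.toEuclideanCLM (n := Fin 3) (𝕜 := ℂ)
    ((LinearMap.toMatrix (EuclideanSpace.basisFun (Fin 3) ℝ).toBasis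
      (EuclideanSpace.basisFun (Fin 3) ℝ).toBasis (T : ℝ³ →ₗ[ℝ] ℝ³)).map (algebraMap ℝ ℂ))

/-- Complexifying the identity gives the identity. [folklore] -/
theorem complexifyCLM_id :
    complexifyCLM (ContinuousLinearMap.id ℝ ℝ³) = ContinuousLinearMap.id ℂ ℂ³ := by
  unfold complexifyCLM
  have h : ((ContinuousLinearMap.id ℝ ℝ³ : ℝ³ →L[ℝ] ℝ³) : ℝ³ →ₗ[ℝ] ℝ³) = LinearMap.id := rfl
  rw [h, LinearMap.toMatrix_id, Matrix.map_one _ (map_zero _) (map_one _), map_one]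
  rfl

/-- The **rotation** of a field by a linear isometry `R` of `ℝ³`: `Rot_R u (x) = R u(R⁻¹ x)`
(Tao 2016, p. 6; Tao takes `R ∈ SO(3)`, imposed in `AveragingDatum.det_R`). On `L²` classes:
precomposition with the measure-preserving `R⁻¹`, then `R` on the values. [cite: Tao2016AveragedNS, §1.1 p. 6] -/
def rot (R : ℝ³ ≃ₗᵢ[ℝ] ℝ³) (u : L2C) : L2C :=
  (complexifyCLM R.toLinearIsometry.toContinuousLinearMap).compLp
    (Lp.compMeasurePreserving R.symm R.symm.measurePreserving u)

/-- `Rot_{id} = id`. [folklore] -/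
theorem rot_refl (u : L2C) : rot (LinearIsometryEquiv.refl ℝ ℝ³) u = u := by
  unfold rot
  have h1 : (LinearIsometryEquiv.refl ℝ ℝ³).toLinearIsometry.toContinuousLinearMap =
      ContinuousLinearMap.id ℝ ℝ³ := rfl
  rw [h1, complexifyCLM_id]
  apply Lp.ext
  filter_upwards [ContinuousLinearMap.coeFn_compLp (ContinuousLinearMap.id ℂ ℂ³)
      (Lp.compMeasurePreserving _ (LinearIsometryEquiv.refl ℝ ℝ³).symm.measurePreserving u),
    Lp.coeFn_compMeasurePreserving u (LinearIsometryEquiv.refl ℝ ℝ³).symm.measurePreserving]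
    with x hx h2
  rw [hx, ContinuousLinearMap.id_apply, h2]
  rfl

/-- `x ↦ u(cx)` is square integrable for `c ≠ 0` (Lebesgue measure scales by `|c|⁻³`). [folklore] -/
theorem memLp_comp_smul {c : ℝ} (hc : c ≠ 0) (u : L2C) :
    MemLp (fun x : ℝ³ => (u : ℝ³ → ℂ³) (c • x)) 2 (volume : Measure ℝ³) := by
  have hmeas : AEMeasurable (fun x : ℝ³ => c • x) (volume : Measure ℝ³) :=
    (measurable_const_smul c).aemeasurable
  refine MemLp.comp_of_map (g := (u : ℝ³ → ℂ³)) ?_ hmeas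
  rw [Measure.map_addHaar_smul volume hc]
  exact (Lp.memLp u).smul_measure ENNReal.ofReal_ne_top

/-- The **dilation** `Dil_λ u (x) = λ^{3/2} u(λx)` of Tao 2016, (1.11) (`λ > 0`; the exponent
`3/2` makes `Dil_λ` unitary on `L²(ℝ³)`), on `L²` classes. Junk: the identity for `λ = 0`. [cite: Tao2016AveragedNS, (1.11)] -/
def dil (c : ℝ) (u : L2C) : L2C :=
  if hc : c = 0 then u else ((c ^ (3 / 2 : ℝ) : ℝ) : ℂ) • (memLp_comp_smul hc u).toLp _

/-- `Dil_1 = id`. [folklore] -/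
theorem dil_one (u : L2C) : dil 1 u = u := by
  unfold dil
  rw [dif_neg one_ne_zero, Real.one_rpow, Complex.ofReal_one, one_smul]
  apply Lp.ext
  filter_upwards [MemLp.coeFn_toLp (memLp_comp_smul one_ne_zero u)] with x hx
  rw [hx, one_smul]

/-! ### Sanity checks, I: the operators annihilate the zero field -/

/-- The `H^s` norm of the zero field vanishes. [folklore] -/
theorem eFourierSobolevNorm_zero (s : ℝ) : FunctionSpaces.eFourierSobolevNorm s (0 : L2C) = 0 := by
  unfold FunctionSpaces.eFourierSobolevNorm
  rw [FourierTransform.fourier_zero]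
  have h' : ∫⁻ ξ, ENNReal.ofReal ((1 + ‖ξ‖ ^ 2) ^ s) *
      ‖((0 : L2C) : ℝ³ → ℂ³) ξ‖ₑ ^ 2 ∂(volume : Measure ℝ³) = 0 := by
    refine (lintegral_congr_ae ?_).trans lintegral_zero
    filter_upwards [Lp.coeFn_zero ℂ³ 2 (volume : Measure ℝ³)] with ξ hξ
    rw [hξ]
    simp
  rw [h', ENNReal.zero_rpow_of_pos (by norm_num)]

/-- `𝓕 0 = 0` a.e. as a function. [folklore] -/
theorem fourierFn_zero : fourierFn 0 =ᵐ[(volume : Measure ℝ³)] 0 := by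
  unfold fourierFn
  rw [FourierTransform.fourier_zero]
  exact Lp.coeFn_zero _ _ _

/-- `0 ∈ H¹⁰_df(ℝ³)`. [folklore] -/
theorem memH10df_zero : MemH10df 0 := by
  refine ⟨by rw [eFourierSobolevNorm_zero]; exact ENNReal.zero_lt_top, ?_, ?_⟩
  · filter_upwards [Lp.coeFn_zero ℂ³ 2 (volume : Measure ℝ³)] with x hx
    intro i
    rw [hx]
    simp
  · filter_upwards [fourierFn_zero] with ξ hξ
    rw [hξ]
    simp [cdot]

/-- The zero curve is continuous in `H¹⁰`. [folklore] -/
theorem continuousInH10On_zero (I : Set ℝ) : ContinuousInH10On I (fun _ => (0 : L2C)) := by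
  intro t₀ _
  simp only [sub_zero, eFourierSobolevNorm_zero]
  exact tendsto_const_nhds

/-- `m • 0 = 0` for the `L^∞ • L²` product. [folklore] -/
theorem lpSMul_zero (m : Lp ℂ ∞ (volume : Measure ℝ³)) : (m • (0 : L2C) : L2C) = 0 := by
  apply Lp.ext
  filter_upwards [Lp.coeFn_lpSMul (r := 2) m (0 : L2C),
    Lp.coeFn_zero ℂ³ 2 (volume : Measure ℝ³)] with x hx h0
  rw [hx, Pi.smul_apply', h0, Pi.zero_apply, smul_zero]

/-- `m(D) 0 = 0`. [folklore] -/
theorem fourierMultiplier_zero (m : Lp ℂ ∞ (volume : Measure ℝ³)) :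
    fourierMultiplier m 0 = 0 := by
  rw [fourierMultiplier, FourierTransform.fourier_zero, lpSMul_zero, FourierTransform.fourierInv_zero]

/-- `e^{τΔ} 0 = 0`. [folklore] -/
theorem heat_apply_zero (τ : ℝ) : heat τ 0 = 0 :=
  fourierMultiplier_zero _

/-- `Rot_R 0 = 0`. [folklore] -/
theorem rot_zero (R : ℝ³ ≃ₗᵢ[ℝ] ℝ³) : rot R 0 = 0 := by
  unfold rot
  rw [map_zero]
  apply Lp.ext
  filter_upwards [ContinuousLinearMap.coeFn_compLp
      (complexifyCLM R.toLinearIsometry.toContinuousLinearMap) (0 : L2C),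
    Lp.coeFn_zero ℂ³ 2 (volume : Measure ℝ³)] with x hx h0
  rw [hx, h0, Pi.zero_apply, map_zero]

/-- `Dil_λ 0 = 0`. [folklore] -/
theorem dil_zero (c : ℝ) : dil c 0 = 0 := by
  unfold dil
  split_ifs with hc
  · rfl
  · have hq : Measure.QuasiMeasurePreserving (fun x : ℝ³ => c • x) volume volume :=
      Measure.quasiMeasurePreserving_smul volume hc
    have h : (memLp_comp_smul hc (0 : L2C)).toLp _ = 0 := by
      apply Lp.ext
      filter_upwards [MemLp.coeFn_toLp (memLp_comp_smul hc (0 : L2C)),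
        hq.ae_eq (Lp.coeFn_zero ℂ³ 2 (volume : Measure ℝ³)),
        Lp.coeFn_zero ℂ³ 2 (volume : Measure ℝ³)] with x h1 h2 h3
      rw [h1, h3]
      exact h2
    rw [h, smul_zero]

/-- `⟨B(0,v), w⟩ = 0`. [folklore] -/
theorem eulerForm_zero_left (v w : L2C) : eulerForm 0 v w = 0 := by
  unfold eulerForm
  have h : ∀ᵐ p : ℝ³ × ℝ³ ∂(volume : Measure (ℝ³ × ℝ³)), fourierFn 0 p.1 = (0 : ℂ³) := by
    rw [Measure.volume_eq_prod]
    exact (Measure.quasiMeasurePreserving_fst (μ := (volume : Measure ℝ³))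
      (ν := (volume : Measure ℝ³))).ae_eq fourierFn_zero
  have h' : ∫ p : ℝ³ × ℝ³, Λ p.1 p.2 (fourierFn 0 p.1) (fourierFn v p.2)
      (fourierFn w (-p.1 - p.2)) = 0 := by
    refine (integral_congr_ae ?_).trans (integral_zero _ _)
    filter_upwards [h] with p hp
    simp [Λ, cdot, hp]
  rw [h', mul_zero]

/-! ### Mild `H¹⁰` solutions for a bilinear forcing given by duality (Tao (1.5), (1.15), (3.3)) -/

/-- **Mild `H¹⁰` solutions of `∂ₜu = Δu + T(u,u)`, `u(0) = u₀`, on a time set `I ∋ 0`**, for a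
bilinear operator `T : H¹⁰_df × H¹⁰_df → (H¹⁰_df)*` given by its trilinear duality form
`(u, v, w) ↦ ⟨T(u,v), w⟩` (Tao 2016: (1.5) for `T = B`, (1.15) for `T = B̃`, and Theorem 3.3 /
(3.3) for a local cascade operator `T = C`): a continuous map `u : I → H¹⁰_df(ℝ³)`
(`MemH10df (u t)` for `t ∈ I`, `ContinuousInH10On I u`) with
`u(t) = e^{tΔ}u₀ + ∫₀ᵗ e^{(t-t')Δ} T(u(t'), u(t')) dt'` for all `t ∈ I`, an identity in
`(H¹⁰_df)* ⊇ L²_σ ⊇ H¹⁰_df` (where `T` takes values and `e^{τΔ}` acts by transposition), written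
as the equivalent family of scalar identities
`⟨u(t), w⟩ = ⟨e^{tΔ}u₀, w⟩ + ∫₀ᵗ ⟨T(u(t'),u(t')), e^{(t-t')Δ} w⟩ dt'` for all `w ∈ H¹⁰_df`.
At `t = 0` this is `⟨u 0, w⟩ = ⟨u₀, w⟩` (`IsMildSolutionFor.initial`). [cite: Tao2016AveragedNS, (1.15)] -/
def IsMildSolutionFor (T : L2C → L2C → L2C → ℂ) (u₀ : L2C) (I : Set ℝ) (u : ℝ → L2C) : Prop :=
  (∀ t ∈ I, MemH10df (u t)) ∧ ContinuousInH10On I u ∧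
    ∀ t ∈ I, ∀ w, MemH10df w →
      pairing (u t) w =
        pairing (heat t u₀) w + ∫ s in (0 : ℝ)..t, T (u s) (u s) (heat (t - s) w)

/-- Mild solutions restrict to smaller time sets. [folklore] -/
theorem IsMildSolutionFor.mono {T : L2C → L2C → L2C → ℂ} {u₀ : L2C} {I J : Set ℝ}
    {u : ℝ → L2C} (h : IsMildSolutionFor T u₀ I u) (hJ : J ⊆ I) :
    IsMildSolutionFor T u₀ J u :=
  ⟨fun t ht => h.1 t (hJ ht), h.2.1.mono hJ, fun t ht => h.2.2 t (hJ ht)⟩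

/-- A mild solution attains its datum in `(H¹⁰_df)*`: `⟨u 0, w⟩ = ⟨u₀, w⟩` for every
`w ∈ H¹⁰_df` (the `t = 0` case: `e^{0Δ} = id`, empty time integral). [cite: Tao2016AveragedNS, (1.15)] -/
theorem IsMildSolutionFor.initial {T : L2C → L2C → L2C → ℂ} {u₀ : L2C} {I : Set ℝ}
    {u : ℝ → L2C} (h : IsMildSolutionFor T u₀ I u) (h0 : (0 : ℝ) ∈ I) {w : L2C}
    (hw : MemH10df w) : pairing (u 0) w = pairing u₀ w := by
  have := h.2.2 0 h0 w hw
  rwa [intervalIntegral.integral_same, add_zero, heat_zero] at this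

/-- **Non-vacuity of the solution notion**: if `⟨T(0,0), ·⟩ = 0` then `u ≡ 0` is a (global)
mild `H¹⁰` solution with datum `0` on every time set. [folklore] -/
theorem isMildSolutionFor_zero {T : L2C → L2C → L2C → ℂ} (hT : ∀ w, T 0 0 w = 0) (I : Set ℝ) :
    IsMildSolutionFor T 0 I (fun _ => 0) := by
  refine ⟨fun _ _ => memH10df_zero, continuousInH10On_zero I, fun t _ w _ => ?_⟩
  simp [heat_apply_zero, hT]

/-! ### Averaged Euler bilinear operators (Tao (1.12)–(1.13)) -/

/-- **Tao's averaging datum** (2016, (1.13) and the surrounding text, p. 6): a probability space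
`(Ω, μ)`; for each slot `i : Fin 3` of (1.12) a random real Fourier symbol of order `0`
`m i θ ∈ 𝓜₀`, a random rotation `R i θ ∈ SO(3)` (a linear isometry of `ℝ³` of determinant `1`)
and a random dilation factor `lam i θ`, with `C⁻¹ ≤ λᵢ ≤ C` for some finite `C`, the **moment
bounds** `∫ ‖m₁‖_{k₁} ‖m₂‖_{k₂} ‖m₃‖_{k₃} dμ < ∞` for all `k₁ k₂ k₃`, and measurability of the
random data (Tao: `θ ↦ m_{i,θ}` Borel measurable into `𝓜₀` with its seminorm topology, which
implies the pointwise measurability recorded here). Sample points are written `θ` (`ω` is an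
ordinal notation in scope). The universe of `Ω` is `Type`, so that `∃ 𝒜 : AveragingDatum, …`
is a small proposition. [cite: Tao2016AveragedNS, (1.13)] -/
structure AveragingDatum where
  /-- The sample space `Ω`. -/
  Ω : Type
  /-- Its σ-algebra. -/
  [mΩ : MeasurableSpace Ω]
  /-- The probability measure `μ`. -/
  μ : Measure Ω
  [isProb : IsProbabilityMeasure μ]
  /-- The three random symbols `m_{i,θ}`. -/
  m : Fin 3 → Ω → ℝ³ → ℂ
  /-- The three random rotations `R_{i,θ}`. -/
  R : Fin 3 → Ω → (ℝ³ ≃ₗᵢ[ℝ] ℝ³)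
  /-- The three random dilation factors `λ_{i,θ}`. -/
  lam : Fin 3 → Ω → ℝ
  /-- Each `m_{i,θ}` is a real Fourier multiplier of order `0`. -/
  isRealSymbol : ∀ i θ, IsRealSymbol (m i θ)
  /-- Each `R_{i,θ}` is a rotation (`SO(3)`, not merely `O(3)`). -/
  det_R : ∀ i θ, LinearMap.det ((R i θ).toLinearEquiv : ℝ³ →ₗ[ℝ] ℝ³) = 1
  /-- Dilation factors are positive … -/
  lam_pos : ∀ i θ, 0 < lam i θ
  /-- … and bounded above and below: `C⁻¹ ≤ λ_{i,θ} ≤ C`. -/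
  lam_bdd : ∃ C : ℝ, ∀ i θ, C⁻¹ ≤ lam i θ ∧ lam i θ ≤ C
  /-- Tao's moment bounds `𝔼 ‖m₁‖_{k₁} ‖m₂‖_{k₂} ‖m₃‖_{k₃} < ∞`. -/
  moment : ∀ k₁ k₂ k₃ : ℕ,
    ∫⁻ θ, symbolSeminorm k₁ (m 0 θ) * symbolSeminorm k₂ (m 1 θ) * symbolSeminorm k₃ (m 2 θ) ∂μ < ∞
  /-- Measurability of the random symbols (off the origin, where `𝓜₀` controls them), … -/
  measurable_m : ∀ i ξ, ξ ≠ 0 → Measurable fun θ => m i θ ξ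
  /-- … rotations, … -/
  measurable_R : ∀ i x, Measurable fun θ => R i θ x
  /-- … and dilation factors. -/
  measurable_lam : ∀ i, Measurable (lam i)

attribute [instance] AveragingDatum.mΩ AveragingDatum.isProb

namespace AveragingDatum

variable (𝒜 : AveragingDatum)

/-- The symbol of slot `i` at the sample `θ`, as an `L^∞` class (`IsRealSymbol.memLp_top`). [cite: Tao2016AveragedNS, §1.1 p. 6] -/
def symbolLp (i : Fin 3) (θ : 𝒜.Ω) : Lp ℂ ∞ (volume : Measure ℝ³) :=
  ((𝒜.isRealSymbol i θ).memLp_top).toLp _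

/-- The random operator of slot `i`, `Aᵢ(θ) = m_{i,θ}(D) ∘ Rot_{R_{i,θ}} ∘ Dil_{λ_{i,θ}}`
(Tao 2016, (1.12): dilate, rotate, then apply the multiplier). [cite: Tao2016AveragedNS, (1.12)] -/
def slot (i : Fin 3) (θ : 𝒜.Ω) (u : L2C) : L2C :=
  fourierMultiplier (𝒜.symbolLp i θ) (rot (𝒜.R i θ) (dil (𝒜.lam i θ) u))

/-- **The averaged Euler trilinear form** `⟨B̃(u,v), w⟩` of the datum `𝒜` (Tao 2016,
(1.12)/(1.13)):
`⟨B̃(u,v), w⟩ = ∫_Ω ⟨B(m_{1,θ}(D) Rot_{R_{1,θ}} Dil_{λ_{1,θ}} u, m_{2,θ}(D) Rot_{R_{2,θ}} Dil_{λ_{2,θ}} v), m_{3,θ}(D) Rot_{R_{3,θ}} Dil_{λ_{3,θ}} w⟩ dμ(θ)`.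
This *is* Tao's definition of the bilinear operator `B̃ : H¹⁰_df × H¹⁰_df → (H¹⁰_df)*` "via
duality". For `u, v, w ∈ H¹⁰_df` the integral converges absolutely (Tao, p. 7); Bochner junk
`0` otherwise. [cite: Tao2016AveragedNS, (1.13)] -/
def form (u v w : L2C) : ℂ :=
  ∫ θ, eulerForm (𝒜.slot 0 θ u) (𝒜.slot 1 θ v) (𝒜.slot 2 θ w) ∂𝒜.μ

/-- `B̃` is **symmetric**: `B̃(u,v) = B̃(v,u)` in `(H¹⁰_df)*` for all `u, v ∈ H¹⁰_df`, i.e.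
`⟨B̃(u,v), w⟩ = ⟨B̃(v,u), w⟩` for all `w ∈ H¹⁰_df` (Tao 2016, Thm. 1.5: "a symmetric averaged
Euler bilinear operator"). A predicate on the datum `𝒜` — the *hypothesis* "symmetric" of
Theorem 1.5 — and not a property of every averaging datum: Tao imposes no symmetry on `μ`,
`Rⱼ`, `mⱼ(D)` (p. 7), and e.g. the deterministic datum `mⱼ ≡ 1`, `Rⱼ = id`, `λ = (2, 1, 1)`,
whose form is `⟨B(Dil₂ u, v), w⟩`, is not symmetric. It holds for the Euler datum
(`AveragingDatum.euler_isSymmetric`, `Literature/Analysis/FluidPDE/TaoAveragedSobolevProofs.lean`)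
and for the symmetrisation of any datum (`AveragingDatum.symmetrize_isSymmetric`,
`Literature/Analysis/FluidPDE/TaoAveragedSobolevSymmetry.lean`). The binder `𝒜` is explicit (rather than the section variable) so that this predicate is not
read as a closed named fact. [cite: Tao2016AveragedNS, Thm. 1.5] -/
def IsSymmetric (𝒜 : AveragingDatum) : Prop :=
  ∀ u v w, MemH10df u → MemH10df v → MemH10df w → 𝒜.form u v w = 𝒜.form v u w

/-- The **cancellation property** (Tao 2016, (1.16)): `⟨B̃(u,u), u⟩ = 0` for all
`u ∈ H¹⁰_df(ℝ³)`. A predicate on the datum `𝒜` — a *hypothesis* in Theorem 1.5 — and not a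
property of every averaging datum (Tao 2016, p. 7: "Because we have not imposed any symmetry or
anti-symmetry hypotheses on the averaging measure `μ`, rotations `Rⱼ`, and Fourier multipliers
`mⱼ(D)`, the analogue [(1.16)] of the cancellation condition [for `B`] is not automatically
satisfied"). The binder `𝒜` is explicit so that this predicate is not read as a closed named
fact. [cite: Tao2016AveragedNS, (1.16)] -/
def HasCancellation (𝒜 : AveragingDatum) : Prop :=
  ∀ u, MemH10df u → 𝒜.form u u u = 0

/-- **Mild `H¹⁰` solutions of the averaged Navier–Stokes equation (1.9)
`∂ₜu = Δu + B̃(u,u)`, `u(0) = u₀`**, on a time set `I` (Tao 2016, (1.15)):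
`IsMildSolutionFor` for the duality form `𝒜.form = ⟨B̃(·,·), ·⟩`. [cite: Tao2016AveragedNS, (1.15)] -/
def IsMildSolution (u₀ : L2C) (I : Set ℝ) (u : ℝ → L2C) : Prop :=
  IsMildSolutionFor 𝒜.form u₀ I u

/-- Mild solutions restrict to smaller time sets. [folklore] -/
theorem IsMildSolution.mono {𝒜 : AveragingDatum} {u₀ : L2C} {I J : Set ℝ} {u : ℝ → L2C}
    (h : 𝒜.IsMildSolution u₀ I u) (hJ : J ⊆ I) : 𝒜.IsMildSolution u₀ J u :=
  IsMildSolutionFor.mono h hJ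

/-- A mild solution attains its datum in `(H¹⁰_df)*`: `⟨u 0, w⟩ = ⟨u₀, w⟩` for every
`w ∈ H¹⁰_df`. [cite: Tao2016AveragedNS, (1.15)] -/
theorem IsMildSolution.initial {𝒜 : AveragingDatum} {u₀ : L2C} {I : Set ℝ} {u : ℝ → L2C}
    (h : 𝒜.IsMildSolution u₀ I u) (h0 : (0 : ℝ) ∈ I) {w : L2C} (hw : MemH10df w) :
    pairing (u 0) w = pairing u₀ w :=
  IsMildSolutionFor.initial h h0 hw

/-! ### Sanity checks, II: the zero field solves the averaged equation with zero data -/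

/-- `Aᵢ(θ) 0 = 0`. [folklore] -/
theorem slot_zero (i : Fin 3) (θ : 𝒜.Ω) : 𝒜.slot i θ 0 = 0 := by
  rw [slot, dil_zero, rot_zero, fourierMultiplier_zero]

/-- `⟨B̃(0,v), w⟩ = 0`. [folklore] -/
theorem form_zero_left (v w : L2C) : 𝒜.form 0 v w = 0 := by
  simp [form, slot_zero, eulerForm_zero_left]

/-- **Non-vacuity of the solution notion**: `u ≡ 0` is a (global) mild `H¹⁰` solution with
datum `0`, for every averaging datum and every time set. [folklore] -/
theorem isMildSolution_zero (I : Set ℝ) : 𝒜.IsMildSolution 0 I (fun _ => 0) :=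
  isMildSolutionFor_zero (𝒜.form_zero_left 0) I

/-- **The Euler datum**: the deterministic datum `mᵢ ≡ 1`, `Rᵢ = id`, `λᵢ = 1`, for which `B̃`
is the Euler bilinear operator `B` itself (Tao 2016, p. 6: `B` is trivially an average of
itself). Serves as the `Inhabited` instance. [folklore] -/
def euler : AveragingDatum where
  Ω := Unit
  μ := Measure.dirac ()
  m := fun _ _ _ => ((1 : ℝ) : ℂ)
  R := fun _ _ => LinearIsometryEquiv.refl ℝ _
  lam := fun _ _ => 1
  isRealSymbol := fun _ _ => isRealSymbol_const 1
  det_R := fun _ _ => LinearMap.det_id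
  lam_pos := fun _ _ => one_pos
  lam_bdd := ⟨1, fun _ _ => by norm_num⟩
  moment := fun k₁ k₂ k₃ => by
    rw [lintegral_dirac]
    have hfin : ∀ k, symbolSeminorm k (fun _ : ℝ³ => ((1 : ℝ) : ℂ)) < ∞ :=
      fun k => (isRealSymbol_const 1).2.1 k
    exact ENNReal.mul_lt_top (ENNReal.mul_lt_top (hfin k₁) (hfin k₂)) (hfin k₃)
  measurable_m := fun _ _ _ => measurable_const
  measurable_R := fun _ _ => measurable_const
  measurable_lam := fun _ => measurable_const

/-- The Euler datum inhabits `AveragingDatum`. [folklore] -/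
instance : Inhabited AveragingDatum := ⟨euler⟩

/-- The slots of the Euler datum are the identity (`1(D) = id`, `Rot_{id} = id`,
`Dil_1 = id`). [folklore] -/
theorem euler_slot (i : Fin 3) (θ : euler.Ω) (u : L2C) : euler.slot i θ u = u := by
  unfold slot
  rw [show euler.lam i θ = 1 from rfl, dil_one,
    show euler.R i θ = LinearIsometryEquiv.refl ℝ _ from rfl, rot_refl]
  have h : euler.symbolLp i θ =
      (memLp_top_const (μ := (volume : Measure ℝ³)) (1 : ℂ)).toLp _ := by
    unfold symbolLp
    exact MemLp.toLp_congr _ _ (Eventually.of_forall fun ξ =>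
      show ((1 : ℝ) : ℂ) = (1 : ℂ) from Complex.ofReal_one)
  rw [h, fourierMultiplier_one]

/-- **The Euler bilinear operator is an averaged Euler bilinear operator**: the form of the
Euler datum is the Euler trilinear form, `⟨B̃(u,v), w⟩ = ⟨B(u,v), w⟩` (Tao 2016, p. 6, the
case `mᵢ ≡ 1`, `Rᵢ = id`, `λᵢ = 1` of (1.13)). [cite: Tao2016AveragedNS, (1.13)] -/
theorem euler_form (u v w : L2C) : euler.form u v w = eulerForm u v w := by
  unfold form
  simp_rw [euler_slot]
  simp [integral_const]

end AveragingDatum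

/-! ### Theorem 1.5 -/

/-- A real Schwartz field lies in `L²` after complexification. [folklore] -/
theorem memLp_complexify_comp (f : 𝓢(ℝ³, ℝ³)) :
    MemLp (FunctionSpaces.EuclideanSpace.complexify ∘ ⇑f) 2 (volume : Measure ℝ³) :=
  ContinuousLinearMap.comp_memLp' FunctionSpaces.EuclideanSpace.complexify.toContinuousLinearMap (f.memLp 2 _)

/-- A real Schwartz vector field `u₀ : 𝓢(ℝ³, ℝ³)` as an element of `L²(ℝ³; ℂ³)` (the class of
`complexify ∘ u₀`); Tao's initial data are "Schwartz divergence-free vector fields `u₀`"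
(Thm. 1.5). [cite: Tao2016AveragedNS, Thm. 1.5] -/
def schwartzL2 (f : 𝓢(ℝ³, ℝ³)) : L2C := (memLp_complexify_comp f).toLp _

/-- **Tao 2016, Theorem 1.5 (Finite time blowup for an averaged Navier–Stokes equation)**, as
printed: *there exist a symmetric averaged Euler bilinear operator
`B̃ : H¹⁰_df(ℝ³) × H¹⁰_df(ℝ³) → H¹⁰_df(ℝ³)*` (i.e. `B̃ = 𝒜.form` for an averaging datum `𝒜` as
in (1.12)–(1.13), symmetric on `H¹⁰_df`) obeying the cancellation property (1.16)
`⟨B̃(u,u), u⟩ = 0` for all `u ∈ H¹⁰_df(ℝ³)`, and a Schwartz divergence-free vector field `u₀`,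
such that there is no global-in-time mild solution `u : [0,+∞) → H¹⁰_df(ℝ³)` (1.15) to the
averaged Navier–Stokes equation (1.9) `∂ₜu = Δu + B̃(u,u)`, `u(0) = u₀`.*

This is the corrected form of the tree's `Literature.Analysis.FluidPDE.tao_averaged_ns_blowup` (same source; the
older files cite it under the interim key `arXiv14020290`); see the module docstring for the three discrepancies (symbol class,
solution concept, locators). Proof in the source: Theorem 1.5 ⇐ Theorem 3.2 (local cascade
operators are averaged Euler operators) + Theorem 3.3 (blow-up for a local cascade equation,
via Lemma 4.1, Theorem 4.2, Theorem 5.3 and Theorem 6.2). A `Prop`-valued definition, not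
asserted here. [cite: Tao2016AveragedNS, Thm. 1.5] -/
def averagedNS_blowup : Prop :=
  ∃ 𝒜 : AveragingDatum, 𝒜.IsSymmetric ∧ 𝒜.HasCancellation ∧
    ∃ u₀ : 𝓢(ℝ³, ℝ³), VectorCalculus.IsDivFree ⇑u₀ ∧
      ¬ ∃ u : ℝ → L2C, 𝒜.IsMildSolution (schwartzL2 u₀) (Ici 0) u

/-- **Global regularity for the averaged Navier–Stokes equation driven by `𝒜`** (the analogue
of Tao's Conjecture 1.2 for (1.9)): every Schwartz divergence-free datum admits a global mild
solution `u : [0,∞) → H¹⁰_df(ℝ³)`. A `Prop`-valued definition. [cite: Tao2016AveragedNS, Conj. 1.2 and (1.9)] -/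
def GlobalRegularity (𝒜 : AveragingDatum) : Prop :=
  ∀ u₀ : 𝓢(ℝ³, ℝ³), VectorCalculus.IsDivFree ⇑u₀ →
    ∃ u : ℝ → L2C, 𝒜.IsMildSolution (schwartzL2 u₀) (Ici 0) u

/-- Theorem 1.5 reformulated as the failure of global regularity for some symmetric averaged
Euler bilinear operator with the cancellation property (Tao 2016, discussion after (1.9),
p. 5: any proof of Conjecture 1.1/1.2 "must use finer structure" than the harmonic-analysis
estimates and the energy identity shared by all such `B̃`). The corrected form of the tree's
`Literature.Analysis.FluidPDE.exists_not_averagedNSGlobalRegularity`; immediate from `averagedNS_blowup`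
(`exists_not_globalRegularity_of_blowup`). [cite: Tao2016AveragedNS, Thm. 1.5] -/
def exists_not_globalRegularity : Prop :=
  ∃ 𝒜 : AveragingDatum, 𝒜.IsSymmetric ∧ 𝒜.HasCancellation ∧ ¬ GlobalRegularity 𝒜

/-- `averagedNS_blowup` implies `exists_not_globalRegularity` (unfolding). [cite: Tao2016AveragedNS, Thm. 1.5] -/
theorem exists_not_globalRegularity_of_blowup (h : averagedNS_blowup) :
    exists_not_globalRegularity := by
  obtain ⟨𝒜, hsymm, hcanc, u₀, hdiv, hno⟩ := h
  exact ⟨𝒜, hsymm, hcanc, fun hreg => hno (hreg u₀ hdiv)⟩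

end Literature.Analysis.FluidPDE.Tao2016
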